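import Mathlib.Analysis.SpecialFunctions.Exp
import Mathlib.Analysis.Complex.Basic
import Mathlib.Analysis.SpecialFunctions.Pow.Real

/-!
# The spectral integrands `χ^discr_u` and `χ_u` (DKLM 2026, Theorem 23 and Part II §1.2)

H. Duminil-Copin, K. K. Kozlowski, P. Lammers, I. Manolescu, *Gaussian free field convergence of
the six-vertex model with `-1 ≤ Δ ≤ -1/2`*, arXiv:2603.06268 (2026) [DKLM2026SixVertexGFF]
(`paper:arxiv-2603.06268`, chunks p0019, p0022, p0024):

> (Theorem 23 / eq. (def_chi_tilde))
> `χ^discr_u(a,b) := ((1-a)^{x₂}e^{-iby₂} - 1)(1-a)^{x₁'}e^{-iby₁'}(1 - (1-a)^{x₁}e^{-iby₁})`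
> for any horizontally ordered `u = (u₁,u₁',u₂,u₂') ∈ (ℤ²)⁴`.
>
> (eq. (chi_u_def)) `χ_u(a,b) := (e^{-ax₂-iby₂} - 1) e^{-ax₁'-iby₁'} (1 - e^{-ax₁-iby₁})` for
> `u ⊂ ℝ²`.
>
> (Proof of Lemma 34, Step 2) `f_n(a,b) := 𝟙{a ≤ 1/δ_n} · χ^discr_{u/δ_n}(δ_n a, δ_n b)`.

* `chiDiscr x₁ y₁ x₁' y₁' x₂ y₂ (a,b)` (`x_i ∈ ℕ`, `y_i ∈ ℤ`) and `conj_chiDiscr`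
  (`conj χ^discr(a,b) = χ^discr(a,-b)`);
* `chiCont x₁ y₁ x₁' y₁' x₂ y₂ (a,b)` (real parameters) and `conj_chiCont`;
* `chiDiscrClamp` — `χ^discr` with `(1-a)` replaced by `(1-a)⁺ = max(1-a, 0)`: a continuous
  function of `(a,b)` which coincides with `𝟙{a ≤ 1} χ^discr` as soon as `x₁' ≥ 1`
  (`indicator_chiDiscr_eq_chiDiscrClamp`) — the truncated integrand `f_n` of Lemma 34 is
  `chiDiscrClamp(δ_n a, δ_n b)` (`continuous_chiDiscrClamp`).

## References

* H. Duminil-Copin, K. K. Kozlowski, P. Lammers, I. Manolescu, arXiv:2603.06268 (2026),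
  Theorem 23, Part II eq. (def_chi_tilde), (chi_u_def), proof of Lemma 34. [DKLM2026SixVertexGFF]
-/

noncomputable section

namespace Literature.Probability.LatticeModels.SixVertex

/-! ## 1. `χ^discr_u` -/

/-- **`χ^discr_u(a,b) := ((1-a)^{x₂}e^{-iby₂} - 1)(1-a)^{x₁'}e^{-iby₁'}(1 - (1-a)^{x₁}e^{-iby₁})`.**
[cite: DKLM2026SixVertexGFF, Theorem 23 and Part II §1.2 (eq. def_chi_tilde)] -/
def chiDiscr (x₁ : ℕ) (y₁ : ℤ) (x₁' : ℕ) (y₁' : ℤ) (x₂ : ℕ) (y₂ : ℤ) (p : ℝ × ℝ) : ℂ :=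
  ((1 - (p.1 : ℂ)) ^ x₂ * Complex.exp (-(Complex.I * p.2 * y₂)) - 1) *
    ((1 - (p.1 : ℂ)) ^ x₁' * Complex.exp (-(Complex.I * p.2 * y₁'))) *
    (1 - (1 - (p.1 : ℂ)) ^ x₁ * Complex.exp (-(Complex.I * p.2 * y₁)))

/-- A conjugated phase. [folklore] -/
theorem conj_cexp_neg_I_mul (b : ℝ) (y : ℂ) (hy : starRingEnd ℂ y = y) :
    starRingEnd ℂ (Complex.exp (-(Complex.I * (b : ℂ) * y))) = Complex.exp (-(Complex.I * ((-b : ℝ) : ℂ) * y)) := by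
  rw [← Complex.exp_conj]
  congr 1
  simp only [map_neg, map_mul, Complex.conj_I, Complex.conj_ofReal, hy, Complex.ofReal_neg]
  ring

/-- `conj χ^discr_u(a,b) = χ^discr_u(a,-b)` (Remark 62: the reflection is complex conjugation).
[cite: DKLM2026SixVertexGFF, Remark 62] -/
theorem conj_chiDiscr (x₁ : ℕ) (y₁ : ℤ) (x₁' : ℕ) (y₁' : ℤ) (x₂ : ℕ) (y₂ : ℤ) (a b : ℝ) :
    starRingEnd ℂ (chiDiscr x₁ y₁ x₁' y₁' x₂ y₂ (a, b)) = chiDiscr x₁ y₁ x₁' y₁' x₂ y₂ (a, -b) := by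
  have h : ∀ y : ℤ, starRingEnd ℂ (Complex.exp (-(Complex.I * (b : ℂ) * y))) =
      Complex.exp (-(Complex.I * ((-b : ℝ) : ℂ) * y)) := fun y => conj_cexp_neg_I_mul b y (map_intCast _ y)
  simp only [chiDiscr, map_mul, map_sub, map_one, map_pow, Complex.conj_ofReal, h]

/-! ## 2. `χ_u` -/

/-- **`χ_u(a,b) := (e^{-ax₂-iby₂} - 1) e^{-ax₁'-iby₁'} (1 - e^{-ax₁-iby₁})`** (continuum version).
[cite: DKLM2026SixVertexGFF, Part II, eq. (chi_u_def)] -/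
def chiCont (x₁ y₁ x₁' y₁' x₂ y₂ : ℝ) (p : ℝ × ℝ) : ℂ :=
  (Complex.exp (-((p.1 : ℂ) * x₂ + Complex.I * p.2 * y₂)) - 1) *
    Complex.exp (-((p.1 : ℂ) * x₁' + Complex.I * p.2 * y₁')) *
    (1 - Complex.exp (-((p.1 : ℂ) * x₁ + Complex.I * p.2 * y₁)))

/-- `χ_u` is continuous. [folklore] -/
theorem continuous_chiCont (x₁ y₁ x₁' y₁' x₂ y₂ : ℝ) : Continuous (chiCont x₁ y₁ x₁' y₁' x₂ y₂) := by
  unfold chiCont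
  fun_prop

/-! ## 3. The clamped discrete integrand -/

/-- The positive part `(1-a)⁺ = max(1-a, 0)`, as a complex number. [folklore] -/
def clampOneSub (a : ℝ) : ℂ := ((max (1 - a) 0 : ℝ) : ℂ)

/-- `(1-a)⁺ = 1 - a` for `a ≤ 1`. [folklore] -/
theorem clampOneSub_of_le {a : ℝ} (ha : a ≤ 1) : clampOneSub a = 1 - (a : ℂ) := by
  rw [clampOneSub, max_eq_left (by linarith)]
  push_cast
  ring

/-- `(1-a)⁺ = 0` for `a ≥ 1`. [folklore] -/
theorem clampOneSub_of_ge {a : ℝ} (ha : 1 ≤ a) : clampOneSub a = 0 := by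
  rw [clampOneSub, max_eq_right (by linarith)]
  simp

/-- `(1-a)⁺` is continuous. [folklore] -/
theorem continuous_clampOneSub : Continuous clampOneSub := by
  unfold clampOneSub
  fun_prop

/-- **The clamped integrand** `χ^discr` with `(1-a)` replaced by `(1-a)⁺`.
[cite: DKLM2026SixVertexGFF, Part II, proof of Lemma 34, Step 2] -/
def chiDiscrClamp (x₁ : ℕ) (y₁ : ℤ) (x₁' : ℕ) (y₁' : ℤ) (x₂ : ℕ) (y₂ : ℤ) (p : ℝ × ℝ) : ℂ :=
  (clampOneSub p.1 ^ x₂ * Complex.exp (-(Complex.I * p.2 * y₂)) - 1) *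
    (clampOneSub p.1 ^ x₁' * Complex.exp (-(Complex.I * p.2 * y₁'))) *
    (1 - clampOneSub p.1 ^ x₁ * Complex.exp (-(Complex.I * p.2 * y₁)))

/-- The clamped integrand is continuous (this is why it replaces `𝟙{a ≤ 1} χ^discr`).
[cite: DKLM2026SixVertexGFF, Part II, proof of Lemma 34, Step 2] -/
theorem continuous_chiDiscrClamp (x₁ : ℕ) (y₁ : ℤ) (x₁' : ℕ) (y₁' : ℤ) (x₂ : ℕ) (y₂ : ℤ) :
    Continuous (chiDiscrClamp x₁ y₁ x₁' y₁' x₂ y₂) := by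
  unfold chiDiscrClamp
  have := continuous_clampOneSub
  fun_prop

/-- On `{a ≤ 1}` the clamp is invisible. [cite: DKLM2026SixVertexGFF, Part II, proof of Lemma 34, Step 2] -/
theorem chiDiscrClamp_of_le (x₁ : ℕ) (y₁ : ℤ) (x₁' : ℕ) (y₁' : ℤ) (x₂ : ℕ) (y₂ : ℤ) {p : ℝ × ℝ} (hp : p.1 ≤ 1) :
    chiDiscrClamp x₁ y₁ x₁' y₁' x₂ y₂ p = chiDiscr x₁ y₁ x₁' y₁' x₂ y₂ p := by
  simp only [chiDiscrClamp, chiDiscr, clampOneSub_of_le hp]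

/-- On `{a ≥ 1}` the clamped integrand vanishes as soon as `x₁' ≥ 1`.
[cite: DKLM2026SixVertexGFF, Part II, proof of Lemma 34, Step 2] -/
theorem chiDiscrClamp_of_ge (x₁ : ℕ) (y₁ : ℤ) {x₁' : ℕ} (hx₁' : 1 ≤ x₁') (y₁' : ℤ) (x₂ : ℕ) (y₂ : ℤ) {p : ℝ × ℝ}
    (hp : 1 ≤ p.1) : chiDiscrClamp x₁ y₁ x₁' y₁' x₂ y₂ p = 0 := by
  simp only [chiDiscrClamp, clampOneSub_of_ge hp, zero_pow (by omega : x₁' ≠ 0), zero_mul, mul_zero]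

/-- **`𝟙{a ≤ 1} χ^discr = χ^discr,clamp`** when `x₁' ≥ 1` (horizontally strictly ordered `u`).
[cite: DKLM2026SixVertexGFF, Part II, proof of Lemma 34, Step 2] -/
theorem indicator_chiDiscr_eq_chiDiscrClamp (x₁ : ℕ) (y₁ : ℤ) {x₁' : ℕ} (hx₁' : 1 ≤ x₁') (y₁' : ℤ) (x₂ : ℕ)
    (y₂ : ℤ) (p : ℝ × ℝ) :
    Set.indicator {p : ℝ × ℝ | p.1 ≤ 1} (chiDiscr x₁ y₁ x₁' y₁' x₂ y₂) p = chiDiscrClamp x₁ y₁ x₁' y₁' x₂ y₂ p := by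
  by_cases hp : p.1 ≤ 1
  · rw [Set.indicator_of_mem (show p ∈ {p : ℝ × ℝ | p.1 ≤ 1} from hp), chiDiscrClamp_of_le _ _ _ _ _ _ hp]
  · rw [Set.indicator_of_notMem (show p ∉ {p : ℝ × ℝ | p.1 ≤ 1} from hp),
      chiDiscrClamp_of_ge _ _ hx₁' _ _ _ (le_of_lt (not_le.1 hp))]

/-- The clamped integrand is bounded by `4`: every factor has modulus `≤ 1` or `≤ 2` (for `a ≥ 0`).
[cite: DKLM2026SixVertexGFF, Part II, proof of Lemma 34] -/
theorem norm_chiDiscrClamp_le (x₁ : ℕ) (y₁ : ℤ) (x₁' : ℕ) (y₁' : ℤ) (x₂ : ℕ) (y₂ : ℤ) {p : ℝ × ℝ} (hp : 0 ≤ p.1) :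
    ‖chiDiscrClamp x₁ y₁ x₁' y₁' x₂ y₂ p‖ ≤ 4 := by
  have hc : ‖clampOneSub p.1‖ ≤ 1 := by
    rw [clampOneSub, Complex.norm_real, Real.norm_eq_abs, abs_of_nonneg (le_max_right _ _)]
    exact max_le (by linarith) zero_le_one
  have hph : ∀ y : ℤ, ‖Complex.exp (-(Complex.I * (p.2 : ℂ) * y))‖ = 1 := by
    intro y
    rw [Complex.norm_exp]
    simp [Complex.mul_re, Complex.mul_im]
  have hpow : ∀ n : ℕ, ‖clampOneSub p.1 ^ n‖ ≤ 1 := fun n => by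
    rw [norm_pow]; exact pow_le_one₀ (norm_nonneg _) hc
  have hf : ∀ (n : ℕ) (y : ℤ), ‖clampOneSub p.1 ^ n * Complex.exp (-(Complex.I * (p.2 : ℂ) * y))‖ ≤ 1 := by
    intro n y
    rw [norm_mul, hph, mul_one]; exact hpow n
  unfold chiDiscrClamp
  calc _ ≤ ‖clampOneSub p.1 ^ x₂ * Complex.exp (-(Complex.I * (p.2 : ℂ) * y₂)) - 1‖ *
        ‖clampOneSub p.1 ^ x₁' * Complex.exp (-(Complex.I * (p.2 : ℂ) * y₁'))‖ *
        ‖(1 : ℂ) - clampOneSub p.1 ^ x₁ * Complex.exp (-(Complex.I * (p.2 : ℂ) * y₁))‖ := by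
          rw [← norm_mul, ← norm_mul]
    _ ≤ 2 * 1 * 2 := by
        gcongr
        · exact (norm_sub_le _ _).trans (by rw [norm_one]; linarith [hf x₂ y₂])
        · exact hf _ _
        · exact (norm_sub_le _ _).trans (by rw [norm_one]; linarith [hf x₁ y₁])
    _ = 4 := by norm_num

end Literature.Probability.LatticeModels.SixVertex

end
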